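import Summits.QuantumFields.YangMills.Theses.PoincareLipschitz
import Summits.QuantumFields.YangMills.Theorems.PoincareLipschitzStretchedStep
import Summits.QuantumFields.YangMills.Theorems.PoincareLipschitzStretchedBudget
import Summits.QuantumFields.YangMills.Theorems.PoincareLipschitzHistoryTailOfLinearTail
import Summits.QuantumFields.YangMills.Theorems.PoincareLipschitzTwoSidedOfConcentrationCounting
import Summits.QuantumFields.YangMills.Theorems.UnitScaleTiltHistoryTailBoundedHeightLocal
import HarnessLib

/-!
# Crux `HistoryTailL` (stmt-QuantumFields-19936), line #12 — THE ψ_α GLUE (S3, THE KNIT):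
# `HistoryTailL ⟸ K1-ψ_α ∧ BlockLipschitzL ∧ MeanDeviationL` FOR EVERY `α > 0` — the K1 organ is a SCALE, not a SHAPE

Cell `ym3-torus` (YM ladder rung R3 = continuum SU(2) Yang–Mills on the 3-torus — NOT d = 4, NOT infinite volume, NOT a mass gap, NOT the Clay
problem), width seat `ym-ust-19936-w4` gen 13; `--supports stmt-QuantumFields-19936 --as helper`.  BY KERNEL, the located remark of the memo
`K1-MESOSCOPIC-LOCATE-w4g12.md` v1.1 §6 (19936 evidence #52): the consumer of line #12 accepts a concentration inequality of ANY stretched-exponential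
shape `Cc·exp(−cc·(√β_K·r∕(n·Λ))^α)` (`α > 0`) for box-local gauge-invariant Lipschitz observables at the Hodge–Poincaré scale `n∕√β_K` — the
registered Gaussian crux `PoincareLipschitz.MesoscopicConcentrationL` (23532) is `α = 2`, the exponential K1-exp of ✓`historyTailL_of_expConcentration`
is `α = 1`, and every `0 < α < 1` (sub-exponential: weak-Poincaré ∕ ψ_α-Orlicz ∕ moment-growth classes, strictly below spectral gap) closes too.
Mechanism: `p_{b₀,p₀}(g)^α = p_{b₀^α, α·p₀}(g)` (S1 ✓`rpow_pFun_eq`), so the height induction runs p-LINEARLY in the re-parametrised TAIL profile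
`(b₀^α, α·p₀)` while the THRESHOLD profile `θBal(b₀,p₀)` is untouched; the arithmetic thresholds `α·p₀ ≥ 1`, `c·b₀^α ≥ 8` are paid by the crux's
PROFILE FREEDOM (`∀ (b₁,p₁) ∃ (b₀,p₀)` beyond).

* (S1 ✓`strTail_of_expTail`, ✓`strTail_of_gaussTail` — the exponential (`α = 1`) and the registered Gaussian (`α = 2`) hypotheses in the ψ_α format.)
* ★`local_tail_str` — the height induction of ✓`local_tail_lin` run with K1-ψ_α: local window tails
  `Gibbs_K({θ(K−j) ≤ dist1 Ū^j(∂a)} ∩ G(a,j)) ≤ Cc·exp(−(cc∕(68(CL+1))^α)·p_{b₀^α,α·p₀}(g_{K−j}))` for `b₀ ≥ (8·(68(CL+1))^α∕cc)^{1∕α}`, `p₀ ≥ 1∕α`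
  (one-height step S1 ✓`local_step_str`, budget S2 ✓`localGood_budget_decoupled`, counting ✓`compl_localGood_subset`∕✓`card_near_le_real`, level 0
  ✓`perPlaquette_boundedHeight_uniform`).
* ★★`historyTailL_of_stretchedTail` (B″) — ✓`historyTailL_of_linearTail` with the supplier's tail p-linear in `(b₀^α, α·p₀)` and a `pmin`.
* ★★★`historyTailL_of_stretchedConcentration (α) (hα : 0 < α) (hC : K1-ψ_α) (hLip : BlockLipschitzL) (hM : MeanDeviationL) : UnitScaleTilt.HistoryTailL`
  BY NAME, with the registered Gaussian face as a corollary (`historyTailL_of_mesoscopicConcentrationL`; the `α = 1` instance IS the landed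
  ✓`PoincareLipschitzLinear.historyTailL_of_expConcentration` via `strTail_of_expTail` — not restated).

HONEST: route glue.  By kernel the K1 organ's CLASS question is reduced to «ψ_α concentration for SOME α > 0 at the scale n∕√β_K»; K1 itself
(in any shape), `BlockLipschitzL`, `MeanDeviationL` are OPEN; nothing of the cruxes, rung R3 or the mass gap is proved.  THEOREMS ONLY, def-free.
[cite: Balaban1985UV3, (7) p.257 and (71) p.273]
-/

set_option autoImplicit false

noncomputable section

namespace Summit.QuantumFields.YangMills.Theorems.PoincareLipschitzStretched

open MeasureTheory
open scoped BigOperators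
open Literature.MathematicalPhysics.QuantumFieldTheory.Balaban1983to89
open Literature.MathematicalPhysics.QuantumFieldTheory.Balaban1983to89.T3ContinuumYM3Torus
open Literature.MathematicalPhysics.QuantumFieldTheory.Balaban1983to89.T3UnitScaleTilt
open Literature.MathematicalPhysics.QuantumFieldTheory.Balaban1983to89.T3UnitLawDensityEML (ℰp measurableE_ℰp)
open Summit.QuantumFields.YangMills.Theorems.HistoryTailBoundedHeightLocal (perPlaquette_boundedHeight_uniform)
open Literature.MathematicalPhysics.QuantumFieldTheory.Balaban1983to89.T3BareTailProfile (bareTailAt)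
open Summit.QuantumFields.YangMills.Theorems.HistoryTailOfTwoSided (historyTailAt_of_bare_finestBad card_plaq_le_pow geometric_profile)
open Summit.QuantumFields.YangMills.Theorems.PoincareLipschitz.TwoSidedOfConcentration
open Summit.QuantumFields.YangMills.Theorems.PoincareLipschitzHistoryTailOfLinearTail (perHeight_bound_lin real_not_plaqSmall_inter_le_sum)

/-! ## §1 The height induction with a ψ_α concentration hypothesis: local window tails, p-linear in the profile `(b₀^α, α·p₀)` -/

/-- ★ **THE LOCAL WINDOW TAIL BY INDUCTION ON THE HEIGHT, FROM K1-ψ_α** (`α > 0`) — ✓`local_tail_lin` run with the stretched-exponential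
concentration hypothesis: for every `L` there are `bmin`, `pmin = 1∕α`, `C = Cc ≥ 0`, `c = cc∕(68(CL+1))^α > 0` such that for all
`b₀ ≥ bmin = (8∕c)^{1∕α}`, `b₀ > 0`, `p₀ ≥ pmin`, `p₀ > 2` some `γ₁ ∈ (0,1]` gives, for every family `F` with `F.L = L`, every `0 < γ ≤ γ₁`, all
`1 ≤ j ≤ K − 2` and every level-`j` plaquette `a`, `Gibbs_K({θ(K−j) ≤ dist1(Ū^j(∂a))} ∩ G(a,j)) ≤ C·exp(−c·p_{b₀^α, α·p₀}(g_{K−j}))` (`G(a,j)` the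
local good set; the tail is p-LINEAR in the re-parametrised profile, the window is `θBal(b₀,p₀)`).  Strong induction on `j` exactly as in the landed
proof, with S1 ✓`local_step_str` and S2 ✓`localGood_budget_decoupled` (finest level in the profile `(b₀,p₀)`, averaged levels in `(b₀^α, α·p₀)`).
[adapted from ✓`PoincareLipschitzLinear.local_tail_lin` ← ✓`PoincareLipschitzTwoSidedOfConcentration.local_tail`;
cite: Balaban1985UV3, (7) p.257 and (71) p.273] -/
theorem local_tail_str {α : ℝ} (hα : 0 < α)
    (hC : ∀ (L : ℕ), ∃ (Cc cc : ℝ), 0 ≤ Cc ∧ 0 < cc ∧ ∃ γ₁ : ℝ, 0 < γ₁ ∧ γ₁ ≤ 1 ∧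
      ∀ (F : T3Family) (γ : ℝ), F.L = L → 0 < γ → γ ≤ γ₁ → ∀ (K n : ℕ), 1 ≤ n →
        (n : ℝ) ≤ (F.scheme ℰp γ).β K → 2 * n ≤ (F.P K).sitesPerDir 0 →
        ∀ (x₀ : Site (F.P K) 0) (f : GaugeField (F.P K) 0 (Matrix.specialUnitaryGroup (Fin 2) ℂ) → ℝ) (Λ : ℝ), 0 < Λ →
          Measurable f → GaugeField.GaugeInvariant f →
          (∀ U U' : GaugeField (F.P K) 0 (Matrix.specialUnitaryGroup (Fin 2) ℂ),
            (∀ b : PBond (F.P K) 0, (∀ k, (b.src k - x₀ k).val < n) → (∀ k, (b.tgt k - x₀ k).val < n) → U b = U' b) →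
              f U = f U') →
          (∀ U U' : GaugeField (F.P K) 0 (Matrix.specialUnitaryGroup (Fin 2) ℂ),
            |f U - f U'| ≤ Λ * Real.sqrt (∑ b : PBond (F.P K) 0, GaugeGroup.dist1 (U b * (U' b)⁻¹) ^ 2)) →
          ∀ r : ℝ, 0 ≤ r →
            (gibbsK F ℰp γ K).real {U | r ≤ f U - ∫ V, f V ∂(gibbsK F ℰp γ K)} ≤
              Cc * Real.exp (-(cc * (Real.sqrt ((F.scheme ℰp γ).β K) * r / ((n : ℝ) * Λ)) ^ α)))
    (hLip : Summit.QuantumFields.YangMills.Theses.PoincareLipschitz.BlockLipschitzL)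
    (hM : Summit.QuantumFields.YangMills.Theses.PoincareLipschitz.MeanDeviationL) (L : ℕ) :
    ∃ (bmin pmin C c : ℝ), 0 ≤ C ∧ 0 < c ∧ ∀ (b₀ p₀ : ℝ), bmin ≤ b₀ → 0 < b₀ → pmin ≤ p₀ → 2 < p₀ →
      ∃ γ₁ : ℝ, 0 < γ₁ ∧ γ₁ ≤ 1 ∧ ∀ (F : T3Family) (γ : ℝ), F.L = L → 0 < γ → γ ≤ γ₁ →
      ∀ (K j : ℕ), 1 ≤ j → j + 2 ≤ K → ∀ a : Plaq (F.P K) j,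
        (gibbsK F ℰp γ K).real ({U : GaugeField (F.P K) 0 (Matrix.specialUnitaryGroup (Fin 2) ℂ) | θBal F.L γ b₀ p₀ (K - j) ≤ GaugeGroup.dist1 (GaugeField.plaqHol (Averaging.iter (fun i' => BlockAveraging.blockAvg (P := F.P K) (j := i') ℰp) j U) a)} ∩ {U : GaugeField (F.P K) 0 (Matrix.specialUnitaryGroup (Fin 2) ℂ) | (∀ (i : ℕ) (q : Plaq (F.P K) i), i < j → Site.tdist (fun k => ((((q.src k).val * F.L ^ i : ℕ)) : ZMod ((F.P K).sitesPerDir 0))) (fun k => ((((a.src k).val * F.L ^ j : ℕ)) : ZMod ((F.P K).sitesPerDir 0))) + 64 * F.L ^ i ≤ 64 * F.L ^ j → GaugeGroup.dist1 (GaugeField.plaqHol (Averaging.iter (fun i' => BlockAveraging.blockAvg (P := F.P K) (j := i') ℰp) i U) q) < θBal F.L γ b₀ p₀ (K - i))}) ≤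
          C * Real.exp (-(c * B10.pFun (b₀ ^ α) (α * p₀) (Real.sqrt (γ * ((F.L : ℝ)⁻¹) ^ (K - j))))) := by
  -- the constants of the three hypotheses and of the level-0 input
  obtain ⟨Cc, cc, hCc, hcc, γC, hγC, hγC1, HC⟩ := hC L
  obtain ⟨CL, hCL, HLip⟩ := hLip L
  obtain ⟨C₀, c₀, hC₀, hc₀, H0⟩ := perPlaquette_boundedHeight_uniform L 0
  -- degenerate block size: no family has `F.L = L < 2`
  by_cases hL : 2 ≤ L
  swap
  · refine ⟨0, 0, 0, 1, le_rfl, one_pos, fun b₀ p₀ _ _ _ _ => ⟨1, one_pos, le_rfl, fun F γ hFL => ?_⟩⟩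
    exact absurd (hFL ▸ F.hL.2) (by omega)
  -- the p-linear rate in the re-parametrised profile `(b₀^α, α·p₀)` and the thresholds `c₁ b₀^α ≥ 8`, `α·p₀ ≥ 1`
  set c₁ : ℝ := cc / (68 * (CL + 1)) ^ α with hc₁
  have hc₁pos : 0 < c₁ := div_pos hcc (Real.rpow_pos_of_pos (by positivity) _)
  refine ⟨(8 / c₁) ^ α⁻¹, α⁻¹, Cc, c₁, hCc, hc₁pos, fun b₀ p₀ hbmin hb₀ hpmin hp₀ => ?_⟩
  have hb' : 0 < b₀ ^ α := Real.rpow_pos_of_pos hb₀ α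
  have hp' : 1 ≤ α * p₀ := by
    have h := mul_le_mul_of_nonneg_left hpmin hα.le
    rwa [mul_inv_cancel₀ hα.ne'] at h
  have hcb : 8 ≤ c₁ * b₀ ^ α := by
    have h8 : 0 ≤ 8 / c₁ := by positivity
    have h1 : ((8 / c₁) ^ α⁻¹) ^ α ≤ b₀ ^ α := Real.rpow_le_rpow (Real.rpow_nonneg h8 _) hbmin hα.le
    rw [Real.rpow_inv_rpow h8 hα.ne'] at h1
    have h2 := mul_le_mul_of_nonneg_left h1 hc₁pos.le
    rwa [mul_div_cancel₀ _ hc₁pos.ne'] at h2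
  obtain ⟨γLip, hγLip, hγLip1, HLip'⟩ := HLip b₀ p₀ hb₀ hp₀
  obtain ⟨γM, hγM, hγM1, HM⟩ := hM L b₀ p₀ hb₀ hp₀
  obtain ⟨γA, hγA, hγA1, HA⟩ := localGood_budget_decoupled hL hb₀ (by linarith : (1 : ℝ) ≤ p₀) hb' hp'
    (by norm_num : (0 : ℝ) ≤ 9 * 129 ^ 3) hC₀ hc₀ hCc hc₁pos hcb
  refine ⟨min γC (min γLip (min γM (min γA (1 / 2)))), by positivity, (min_le_left _ _).trans hγC1,
    fun F γ hFL hγ hγle K => ?_⟩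
  have hγC' : γ ≤ γC := hγle.trans (min_le_left _ _)
  have hγLip' : γ ≤ γLip := hγle.trans ((min_le_right _ _).trans (min_le_left _ _))
  have hγM' : γ ≤ γM := hγle.trans ((min_le_right _ _).trans ((min_le_right _ _).trans (min_le_left _ _)))
  have hγA' : γ ≤ γA :=
    hγle.trans ((min_le_right _ _).trans ((min_le_right _ _).trans ((min_le_right _ _).trans (min_le_left _ _))))
  have hγ2 : γ ≤ 1 / 2 :=
    hγle.trans ((min_le_right _ _).trans ((min_le_right _ _).trans ((min_le_right _ _).trans (min_le_right _ _))))
  have hγ1 : γ ≤ 1 := by linarith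
  subst hFL
  haveI := isProbabilityMeasure_gibbsK F ℰp hγ.le K
  have hβ : (F.scheme ℰp γ).β K = (γ * ((F.L : ℝ)⁻¹) ^ K)⁻¹ := rfl
  -- strong induction on the level `j`
  intro j
  induction j using Nat.strong_induction_on with
  | _ j ih =>
  intro hj hjK a
  -- the complement of the local good set is rare
  have hGc : (gibbsK F ℰp γ K).real {U : GaugeField (F.P K) 0 (Matrix.specialUnitaryGroup (Fin 2) ℂ) | (∀ (i : ℕ) (q : Plaq (F.P K) i), i < j → Site.tdist (fun k => ((((q.src k).val * F.L ^ i : ℕ)) : ZMod ((F.P K).sitesPerDir 0))) (fun k => ((((a.src k).val * F.L ^ j : ℕ)) : ZMod ((F.P K).sitesPerDir 0))) + 64 * F.L ^ i ≤ 64 * F.L ^ j → GaugeGroup.dist1 (GaugeField.plaqHol (Averaging.iter (fun i' => BlockAveraging.blockAvg (P := F.P K) (j := i') ℰp) i U) q) < θBal F.L γ b₀ p₀ (K - i))}ᶜ ≤ 1 / 4 := by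
    have hcov := compl_localGood_subset F (X := GaugeField (F.P K) 0 (Matrix.specialUnitaryGroup (Fin 2) ℂ)) K j a
      (fun i q U => GaugeGroup.dist1 (GaugeField.plaqHol (Averaging.iter (fun i' => BlockAveraging.blockAvg (P := F.P K) (j := i') ℰp) i U) q)) (fun i => θBal F.L γ b₀ p₀ (K - i))
    beta_reduce at hcov
    -- level 0: the tree's volume-uniform finest-level tail
    have h0 : ∀ q : Plaq (F.P K) 0, (gibbsK F ℰp γ K).real ({U : GaugeField (F.P K) 0 (Matrix.specialUnitaryGroup (Fin 2) ℂ) | θBal F.L γ b₀ p₀ (K - 0) ≤ GaugeGroup.dist1 (GaugeField.plaqHol (Averaging.iter (fun i' => BlockAveraging.blockAvg (P := F.P K) (j := i') ℰp) 0 U) q)} ∩ {U : GaugeField (F.P K) 0 (Matrix.specialUnitaryGroup (Fin 2) ℂ) | (∀ (i' : ℕ) (q' : Plaq (F.P K) i'), i' < 0 → Site.tdist (fun k => ((((q'.src k).val * F.L ^ i' : ℕ)) : ZMod ((F.P K).sitesPerDir 0))) (fun k => ((((q.src k).val * F.L ^ 0 : ℕ)) : ZMod ((F.P K).sitesPerDir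 0))) + 64 * F.L ^ i' ≤ 64 * F.L ^ 0 → GaugeGroup.dist1 (GaugeField.plaqHol (Averaging.iter (fun i' => BlockAveraging.blockAvg (P := F.P K) (j := i') ℰp) i' U) q') < θBal F.L γ b₀ p₀ (K - i'))}) ≤
        C₀ * ((γ * ((F.L : ℝ)⁻¹) ^ K)⁻¹) ^ 5 * Real.exp (-(c₀ * B10.pFun b₀ p₀ (Real.sqrt (γ * ((F.L : ℝ)⁻¹) ^ (K))) ^ 2)) := by
      intro q
      have h := H0 F rfl γ hγ hγ1 b₀ hb₀.le p₀ K 0 (Nat.zero_le K) le_rfl q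
      simp only [Nat.sub_zero] at h
      rw [hβ] at h
      exact (measureReal_mono Set.inter_subset_left (measure_ne_top _ _)).trans h
    -- levels `1 ≤ i < j`: the induction hypothesis
    have hi : ∀ i ∈ Finset.Ico 1 j, ∀ q : Plaq (F.P K) i, (gibbsK F ℰp γ K).real ({U : GaugeField (F.P K) 0 (Matrix.specialUnitaryGroup (Fin 2) ℂ) | θBal F.L γ b₀ p₀ (K - i) ≤ GaugeGroup.dist1 (GaugeField.plaqHol (Averaging.iter (fun i' => BlockAveraging.blockAvg (P := F.P K) (j := i') ℰp) i U) q)} ∩ {U : GaugeField (F.P K) 0 (Matrix.specialUnitaryGroup (Fin 2) ℂ) | (∀ (i' : ℕ) (q' : Plaq (F.P K) i'), i' < i → Site.tdist (fun k => ((((q'.src k).val * F.L ^ i' : ℕ)) : ZMod ((F.P K).sitesPerDir 0))) (fun k => ((((q.src k).val * F.L ^ i : ℕ)) : ZMod ((F.P K).sitesPerDir 0))) + 64 * F.L ^ i' ≤ 64 * F.L ^ i → GaugeGroup.dist1 (GaugeField.plaqHol (Averaging.iter (fun i' => BlockAveraging.blockAvg (P := F.P K) (j := i') ℰp) i' U)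 q') < θBal F.L γ b₀ p₀ (K - i'))}) ≤
        Cc * Real.exp (-(c₁ * B10.pFun (b₀ ^ α) (α * p₀) (Real.sqrt (γ * ((F.L : ℝ)⁻¹) ^ (K - i))))) := by
      intro i hi q
      rw [Finset.mem_Ico] at hi
      exact ih i hi.2 hi.1 (by omega) q
    -- the counts
    have hN : ∀ i, i ≤ j → (((Finset.univ.filter fun q : Plaq (F.P K) i => Site.tdist (fun k => ((((q.src k).val * F.L ^ i : ℕ)) : ZMod ((F.P K).sitesPerDir 0))) (fun k => ((((a.src k).val * F.L ^ j : ℕ)) : ZMod ((F.P K).sitesPerDir 0))) + 64 * F.L ^ i ≤ 64 * F.L ^ j)).card : ℝ) ≤ 9 * 129 ^ 3 * ((F.L : ℝ) ^ (j - i)) ^ 3 :=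
      fun i hij => card_near_le_real F hij (by omega) a
    calc (gibbsK F ℰp γ K).real {U : GaugeField (F.P K) 0 (Matrix.specialUnitaryGroup (Fin 2) ℂ) | (∀ (i : ℕ) (q : Plaq (F.P K) i), i < j → Site.tdist (fun k => ((((q.src k).val * F.L ^ i : ℕ)) : ZMod ((F.P K).sitesPerDir 0))) (fun k => ((((a.src k).val * F.L ^ j : ℕ)) : ZMod ((F.P K).sitesPerDir 0))) + 64 * F.L ^ i ≤ 64 * F.L ^ j → GaugeGroup.dist1 (GaugeField.plaqHol (Averaging.iter (fun i' => BlockAveraging.blockAvg (P := F.P K) (j := i') ℰp) i U) q) < θBal F.L γ b₀ p₀ (K - i))}ᶜ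
        ≤ (gibbsK F ℰp γ K).real (⋃ i ∈ Finset.range j, ⋃ q ∈ (Finset.univ.filter fun q : Plaq (F.P K) i => Site.tdist (fun k => ((((q.src k).val * F.L ^ i : ℕ)) : ZMod ((F.P K).sitesPerDir 0))) (fun k => ((((a.src k).val * F.L ^ j : ℕ)) : ZMod ((F.P K).sitesPerDir 0))) + 64 * F.L ^ i ≤ 64 * F.L ^ j), ({U : GaugeField (F.P K) 0 (Matrix.specialUnitaryGroup (Fin 2) ℂ) | θBal F.L γ b₀ p₀ (K - i) ≤ GaugeGroup.dist1 (GaugeField.plaqHol (Averaging.iter (fun i' => BlockAveraging.blockAvg (P := F.P K) (j := i') ℰp) i U) q)} ∩ {U : GaugeField (F.P K) 0 (Matrix.specialUnitaryGroup (Fin 2) ℂ) | (∀ (i' : ℕ) (q' : Plaq (F.P K) i'), i' < i → Site.tdist (fun k => ((((q'.src k).val * F.L ^ i' : ℕ)) : ZMod ((F.P K).sitesPerDir 0))) (fun k => ((((q.src k).val * F.L ^ i : ℕ)) : ZMod ((F.P K).sitesPerDir 0))) + 64 * F.L ^ i' ≤ 64 * F.L ^ i → GaugeGroup.dist1 (GaugeField.plaqHol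 (Averaging.iter (fun i' => BlockAveraging.blockAvg (P := F.P K) (j := i') ℰp) i' U) q') < θBal F.L γ b₀ p₀ (K - i'))})) :=
          measureReal_mono hcov (measure_ne_top _ _)
      _ ≤ ∑ i ∈ Finset.range j, (gibbsK F ℰp γ K).real (⋃ q ∈ (Finset.univ.filter fun q : Plaq (F.P K) i => Site.tdist (fun k => ((((q.src k).val * F.L ^ i : ℕ)) : ZMod ((F.P K).sitesPerDir 0))) (fun k => ((((a.src k).val * F.L ^ j : ℕ)) : ZMod ((F.P K).sitesPerDir 0))) + 64 * F.L ^ i ≤ 64 * F.L ^ j), ({U : GaugeField (F.P K) 0 (Matrix.specialUnitaryGroup (Fin 2) ℂ) | θBal F.L γ b₀ p₀ (K - i) ≤ GaugeGroup.dist1 (GaugeField.plaqHol (Averaging.iter (fun i' => BlockAveraging.blockAvg (P := F.P K) (j := i') ℰp) i U) q)} ∩ {U : GaugeField (F.P K) 0 (Matrix.specialUnitaryGroup (Fin 2) ℂ) | (∀ (i' : ℕ) (q' : Plaq (F.P K) i'), i' < i → Site.tdist (fun k => ((((q'.src k).val * F.L ^ i' : ℕ)) : ZMod ((F.P K).sitesPerDir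 0))) (fun k => ((((q.src k).val * F.L ^ i : ℕ)) : ZMod ((F.P K).sitesPerDir 0))) + 64 * F.L ^ i' ≤ 64 * F.L ^ i → GaugeGroup.dist1 (GaugeField.plaqHol (Averaging.iter (fun i' => BlockAveraging.blockAvg (P := F.P K) (j := i') ℰp) i' U) q') < θBal F.L γ b₀ p₀ (K - i'))})) :=
          measureReal_biUnion_finset_le _ _
      _ ≤ ∑ i ∈ Finset.range j, ∑ q ∈ (Finset.univ.filter fun q : Plaq (F.P K) i => Site.tdist (fun k => ((((q.src k).val * F.L ^ i : ℕ)) : ZMod ((F.P K).sitesPerDir 0))) (fun k => ((((a.src k).val * F.L ^ j : ℕ)) : ZMod ((F.P K).sitesPerDir 0))) + 64 * F.L ^ i ≤ 64 * F.L ^ j), (gibbsK F ℰp γ K).real ({U : GaugeField (F.P K) 0 (Matrix.specialUnitaryGroup (Fin 2) ℂ) | θBal F.L γ b₀ p₀ (K - i) ≤ GaugeGroup.dist1 (GaugeField.plaqHol (Averaging.iter (fun i' => BlockAveraging.blockAvg (P := F.P K) (j := i') ℰp) i U) q)} ∩ {U : GaugeField (F.P K) 0 (Matrix.specialUnitaryGroup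 (Fin 2) ℂ) | (∀ (i' : ℕ) (q' : Plaq (F.P K) i'), i' < i → Site.tdist (fun k => ((((q'.src k).val * F.L ^ i' : ℕ)) : ZMod ((F.P K).sitesPerDir 0))) (fun k => ((((q.src k).val * F.L ^ i : ℕ)) : ZMod ((F.P K).sitesPerDir 0))) + 64 * F.L ^ i' ≤ 64 * F.L ^ i → GaugeGroup.dist1 (GaugeField.plaqHol (Averaging.iter (fun i' => BlockAveraging.blockAvg (P := F.P K) (j := i') ℰp) i' U) q') < θBal F.L γ b₀ p₀ (K - i'))}) :=
          Finset.sum_le_sum fun i _ => measureReal_biUnion_finset_le _ _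
      _ = ∑ q ∈ (Finset.univ.filter fun q : Plaq (F.P K) 0 => Site.tdist (fun k => ((((q.src k).val * F.L ^ 0 : ℕ)) : ZMod ((F.P K).sitesPerDir 0))) (fun k => ((((a.src k).val * F.L ^ j : ℕ)) : ZMod ((F.P K).sitesPerDir 0))) + 64 * F.L ^ 0 ≤ 64 * F.L ^ j), (gibbsK F ℰp γ K).real ({U : GaugeField (F.P K) 0 (Matrix.specialUnitaryGroup (Fin 2) ℂ) | θBal F.L γ b₀ p₀ (K - 0) ≤ GaugeGroup.dist1 (GaugeField.plaqHol (Averaging.iter (fun i' => BlockAveraging.blockAvg (P := F.P K) (j := i') ℰp) 0 U) q)} ∩ {U : GaugeField (F.P K) 0 (Matrix.specialUnitaryGroup (Fin 2) ℂ) | (∀ (i' : ℕ) (q' : Plaq (F.P K) i'), i' < 0 → Site.tdist (fun k => ((((q'.src k).val * F.L ^ i' : ℕ)) : ZMod ((F.P K).sitesPerDir 0))) (fun k => ((((q.src k).val * F.L ^ 0 : ℕ)) : ZMod ((F.P K).sitesPerDir 0))) + 64 * F.L ^ i' ≤ 64 * F.L ^ 0 → GaugeGroup.dist1 (GaugeField.plaqHol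 (Averaging.iter (fun i' => BlockAveraging.blockAvg (P := F.P K) (j := i') ℰp) i' U) q') < θBal F.L γ b₀ p₀ (K - i'))}) +
            ∑ i ∈ Finset.Ico 1 j, ∑ q ∈ (Finset.univ.filter fun q : Plaq (F.P K) i => Site.tdist (fun k => ((((q.src k).val * F.L ^ i : ℕ)) : ZMod ((F.P K).sitesPerDir 0))) (fun k => ((((a.src k).val * F.L ^ j : ℕ)) : ZMod ((F.P K).sitesPerDir 0))) + 64 * F.L ^ i ≤ 64 * F.L ^ j), (gibbsK F ℰp γ K).real ({U : GaugeField (F.P K) 0 (Matrix.specialUnitaryGroup (Fin 2) ℂ) | θBal F.L γ b₀ p₀ (K - i) ≤ GaugeGroup.dist1 (GaugeField.plaqHol (Averaging.iter (fun i' => BlockAveraging.blockAvg (P := F.P K) (j := i') ℰp) i U) q)} ∩ {U : GaugeField (F.P K) 0 (Matrix.specialUnitaryGroup (Fin 2) ℂ) | (∀ (i' : ℕ) (q' : Plaq (F.P K) i'), i' < i → Site.tdist (fun k => ((((q'.src k).val * F.L ^ i' : ℕ)) : ZMod ((F.P K).sitesPerDir 0))) (fun k => ((((q.src k).val * F.L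 ^ i : ℕ)) : ZMod ((F.P K).sitesPerDir 0))) + 64 * F.L ^ i' ≤ 64 * F.L ^ i → GaugeGroup.dist1 (GaugeField.plaqHol (Averaging.iter (fun i' => BlockAveraging.blockAvg (P := F.P K) (j := i') ℰp) i' U) q') < θBal F.L γ b₀ p₀ (K - i'))}) := by
          rw [Finset.range_eq_Ico, Finset.sum_eq_sum_Ico_succ_bot hj]
      _ ≤ 9 * 129 ^ 3 * ((F.L : ℝ) ^ j) ^ 3 * (C₀ * ((γ * ((F.L : ℝ)⁻¹) ^ K)⁻¹) ^ 5 * Real.exp (-(c₀ * B10.pFun b₀ p₀ (Real.sqrt (γ * ((F.L : ℝ)⁻¹) ^ (K))) ^ 2))) +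
            ∑ i ∈ Finset.Ico 1 j, 9 * 129 ^ 3 * ((F.L : ℝ) ^ (j - i)) ^ 3 * (Cc * Real.exp (-(c₁ * B10.pFun (b₀ ^ α) (α * p₀) (Real.sqrt (γ * ((F.L : ℝ)⁻¹) ^ (K - i)))))) := by
          refine add_le_add ?_ (Finset.sum_le_sum fun i hi' => ?_)
          · calc ∑ q ∈ (Finset.univ.filter fun q : Plaq (F.P K) 0 => Site.tdist (fun k => ((((q.src k).val * F.L ^ 0 : ℕ)) : ZMod ((F.P K).sitesPerDir 0))) (fun k => ((((a.src k).val * F.L ^ j : ℕ)) : ZMod ((F.P K).sitesPerDir 0))) + 64 * F.L ^ 0 ≤ 64 * F.L ^ j), (gibbsK F ℰp γ K).real ({U : GaugeField (F.P K) 0 (Matrix.specialUnitaryGroup (Fin 2) ℂ) | θBal F.L γ b₀ p₀ (K - 0) ≤ GaugeGroup.dist1 (GaugeField.plaqHol (Averaging.iter (fun i' => BlockAveraging.blockAvg (P := F.P K) (j := i') ℰp) 0 U) q)} ∩ {U : GaugeField (F.P K) 0 (Matrix.specialUnitaryGroup (Fin 2) ℂ) | (∀ (i' : ℕ) (q' :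 Plaq (F.P K) i'), i' < 0 → Site.tdist (fun k => ((((q'.src k).val * F.L ^ i' : ℕ)) : ZMod ((F.P K).sitesPerDir 0))) (fun k => ((((q.src k).val * F.L ^ 0 : ℕ)) : ZMod ((F.P K).sitesPerDir 0))) + 64 * F.L ^ i' ≤ 64 * F.L ^ 0 → GaugeGroup.dist1 (GaugeField.plaqHol (Averaging.iter (fun i' => BlockAveraging.blockAvg (P := F.P K) (j := i') ℰp) i' U) q') < θBal F.L γ b₀ p₀ (K - i'))})
                ≤ ∑ q ∈ (Finset.univ.filter fun q : Plaq (F.P K) 0 => Site.tdist (fun k => ((((q.src k).val * F.L ^ 0 : ℕ)) : ZMod ((F.P K).sitesPerDir 0))) (fun k => ((((a.src k).val * F.L ^ j : ℕ)) : ZMod ((F.P K).sitesPerDir 0))) + 64 * F.L ^ 0 ≤ 64 * F.L ^ j), C₀ * ((γ * ((F.L : ℝ)⁻¹) ^ K)⁻¹) ^ 5 * Real.exp (-(c₀ * B10.pFun b₀ p₀ (Real.sqrt (γ * ((F.L : ℝ)⁻¹) ^ (K))) ^ 2)) :=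
                  Finset.sum_le_sum fun q _ => h0 q
              _ = ((Finset.univ.filter fun q : Plaq (F.P K) 0 => Site.tdist (fun k => ((((q.src k).val * F.L ^ 0 : ℕ)) : ZMod ((F.P K).sitesPerDir 0))) (fun k => ((((a.src k).val * F.L ^ j : ℕ)) : ZMod ((F.P K).sitesPerDir 0))) + 64 * F.L ^ 0 ≤ 64 * F.L ^ j)).card * (C₀ * ((γ * ((F.L : ℝ)⁻¹) ^ K)⁻¹) ^ 5 * Real.exp (-(c₀ * B10.pFun b₀ p₀ (Real.sqrt (γ * ((F.L : ℝ)⁻¹) ^ (K))) ^ 2))) := by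
                  rw [Finset.sum_const, nsmul_eq_mul]
              _ ≤ 9 * 129 ^ 3 * ((F.L : ℝ) ^ j) ^ 3 * (C₀ * ((γ * ((F.L : ℝ)⁻¹) ^ K)⁻¹) ^ 5 * Real.exp (-(c₀ * B10.pFun b₀ p₀ (Real.sqrt (γ * ((F.L : ℝ)⁻¹) ^ (K))) ^ 2))) := by
                  have h := hN 0 (Nat.zero_le j)
                  rw [Nat.sub_zero] at h
                  exact mul_le_mul_of_nonneg_right h (by positivity)
          · calc ∑ q ∈ (Finset.univ.filter fun q : Plaq (F.P K) i => Site.tdist (fun k => ((((q.src k).val * F.L ^ i : ℕ)) : ZMod ((F.P K).sitesPerDir 0))) (fun k => ((((a.src k).val * F.L ^ j : ℕ)) : ZMod ((F.P K).sitesPerDir 0))) + 64 * F.L ^ i ≤ 64 * F.L ^ j), (gibbsK F ℰp γ K).real ({U : GaugeField (F.P K) 0 (Matrix.specialUnitaryGroup (Fin 2) ℂ) | θBal F.L γ b₀ p₀ (K - i) ≤ GaugeGroup.dist1 (GaugeField.plaqHol (Averaging.iter (fun i' => BlockAveraging.blockAvg (P := F.P K) (j := i') ℰp) i U) q)} ∩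 {U : GaugeField (F.P K) 0 (Matrix.specialUnitaryGroup (Fin 2) ℂ) | (∀ (i' : ℕ) (q' : Plaq (F.P K) i'), i' < i → Site.tdist (fun k => ((((q'.src k).val * F.L ^ i' : ℕ)) : ZMod ((F.P K).sitesPerDir 0))) (fun k => ((((q.src k).val * F.L ^ i : ℕ)) : ZMod ((F.P K).sitesPerDir 0))) + 64 * F.L ^ i' ≤ 64 * F.L ^ i → GaugeGroup.dist1 (GaugeField.plaqHol (Averaging.iter (fun i' => BlockAveraging.blockAvg (P := F.P K) (j := i') ℰp) i' U) q') < θBal F.L γ b₀ p₀ (K - i'))})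
                ≤ ∑ q ∈ (Finset.univ.filter fun q : Plaq (F.P K) i => Site.tdist (fun k => ((((q.src k).val * F.L ^ i : ℕ)) : ZMod ((F.P K).sitesPerDir 0))) (fun k => ((((a.src k).val * F.L ^ j : ℕ)) : ZMod ((F.P K).sitesPerDir 0))) + 64 * F.L ^ i ≤ 64 * F.L ^ j), Cc * Real.exp (-(c₁ * B10.pFun (b₀ ^ α) (α * p₀) (Real.sqrt (γ * ((F.L : ℝ)⁻¹) ^ (K - i))))) :=
                  Finset.sum_le_sum fun q _ => hi i hi' q
              _ = ((Finset.univ.filter fun q : Plaq (F.P K) i => Site.tdist (fun k => ((((q.src k).val * F.L ^ i : ℕ)) : ZMod ((F.P K).sitesPerDir 0))) (fun k => ((((a.src k).val * F.L ^ j : ℕ)) : ZMod ((F.P K).sitesPerDir 0))) + 64 * F.L ^ i ≤ 64 * F.L ^ j)).card * (Cc * Real.exp (-(c₁ * B10.pFun (b₀ ^ α) (α * p₀) (Real.sqrt (γ * ((F.L : ℝ)⁻¹) ^ (K - i)))))) := by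
                  rw [Finset.sum_const, nsmul_eq_mul]
              _ ≤ 9 * 129 ^ 3 * ((F.L : ℝ) ^ (j - i)) ^ 3 * (Cc * Real.exp (-(c₁ * B10.pFun (b₀ ^ α) (α * p₀) (Real.sqrt (γ * ((F.L : ℝ)⁻¹) ^ (K - i)))))) :=
                  mul_le_mul_of_nonneg_right (hN i (Finset.mem_Ico.mp hi').2.le) (by positivity)
      _ ≤ 1 / 4 := HA γ hγ hγA' K j (by omega)
  exact local_step_str F hγ hγ2 hb₀ hjK a hCL (HC F γ rfl hγ hγC' K) (HLip' F γ rfl hγ hγLip' K j hj hjK a)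
    (HM F γ rfl hγ hγM' K j hj (by omega) a) hGc

/-! ## §2 `HistoryTailL` from finest-bad-level tails that are p-linear in a RE-PARAMETRISED profile (B″) -/

/-- ★★ **`UnitScaleTilt.HistoryTailL` FROM PER-PLAQUETTE FINEST-BAD-LEVEL TAILS, p-LINEAR IN THE PROFILE `(b₀^α, α·p₀)`** (`α > 0`).  As
✓`historyTailL_of_linearTail` (B′), but the supplier's tail is `C·exp(−c·p_{b₀^α, α·p₀}(g_{K−j}))` — the shape a ψ_α concentration inequality
delivers at the window `θBal(b₀,p₀)` (✓`local_tail_str`) — and the supplier may ask for `p₀ ≥ pmin` besides `b₀ ≥ bmin`.  PROFILE FREEDOM pays for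
both: the parent crux lets the profile be chosen beyond any floor `(b₁, p₁)`, so `b₀ := max b₁ (max bmin (max ((16∕c)^{1∕α}) 1))` (then
`c·b₀^α ≥ 16`) and `p₀ := max p₁ (max 3 (max pmin α⁻¹))` (then `α·p₀ ≥ 1`), after which the proof is B′ VERBATIM: the shape-agnostic reduction
✓`historyTailAt_of_bare_finestBad` with the landed bare profile ✓`bareTailAt`, the plaquette union bound ✓`real_not_plaqSmall_inter_le_sum`,
✓`card_plaq_le_pow` and the p-linear per-height arithmetic ✓`perHeight_bound_lin` run AT THE PROFILE `(b₀^α, α·p₀)` (`A = 0`).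
Route glue only; `hT` is NOT proved. [cite: Balaban1985UV3, (7) p.257 and (71) p.273] -/
theorem historyTailL_of_stretchedTail {α : ℝ} (hα : 0 < α)
    (hT : ∀ (L : ℕ), ∃ (bmin pmin C c : ℝ), 0 ≤ C ∧ 0 < c ∧ ∀ (b₀ p₀ : ℝ), bmin ≤ b₀ → 0 < b₀ → pmin ≤ p₀ → 2 < p₀ →
      ∃ γ₁ : ℝ, 0 < γ₁ ∧ γ₁ ≤ 1 ∧ ∀ (F : T3Family) (γ : ℝ), F.L = L → 0 < γ → γ ≤ γ₁ →
        ∀ (K j : ℕ), 1 ≤ j → j + 2 ≤ K → ∀ a : Plaq (F.P K) j,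
          (gibbsK F ℰp γ K).real
              ({U : GaugeField (F.P K) 0 (Matrix.specialUnitaryGroup (Fin 2) ℂ) |
                  θBal F.L γ b₀ p₀ (K - j) ≤ GaugeGroup.dist1 (GaugeField.plaqHol
                    (Averaging.iter (fun i' => BlockAveraging.blockAvg (P := F.P K) (j := i') ℰp) j U) a)} ∩
                {U : GaugeField (F.P K) 0 (Matrix.specialUnitaryGroup (Fin 2) ℂ) | ∀ i, i < j →
                  PlaqSmall (θBal F.L γ b₀ p₀ (K - i))
                    (Averaging.iter (fun i' => BlockAveraging.blockAvg (P := F.P K) (j := i') ℰp) i U)}) ≤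
            C * Real.exp (-(c * B10.pFun (b₀ ^ α) (α * p₀) (Real.sqrt (γ * ((F.L : ℝ)⁻¹) ^ (K - j)))))) :
    Summit.QuantumFields.YangMills.Theses.UnitScaleTilt.HistoryTailL := by
  intro L b₁ p₁
  obtain ⟨bmin, pmin, C, c, hC, hc, H⟩ := hT L
  -- the profile above the floor, above the supplier's thresholds and above the arithmetic thresholds `16 ≤ c·b₀^α`, `1 ≤ α·p₀`
  obtain ⟨b₀, hb₁, hbmin, hbc, hb₀1⟩ : ∃ b₀ : ℝ, b₁ ≤ b₀ ∧ bmin ≤ b₀ ∧ (16 / c) ^ α⁻¹ ≤ b₀ ∧ 1 ≤ b₀ :=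
    ⟨max b₁ (max bmin (max ((16 / c) ^ α⁻¹) 1)), le_max_left _ _, le_max_of_le_right (le_max_left _ _),
      le_max_of_le_right (le_max_of_le_right (le_max_left _ _)),
      le_max_of_le_right (le_max_of_le_right (le_max_right _ _))⟩
  obtain ⟨p₀, hp₁, hp₀, hpmin, hpα⟩ : ∃ p₀ : ℝ, p₁ ≤ p₀ ∧ 2 < p₀ ∧ pmin ≤ p₀ ∧ α⁻¹ ≤ p₀ :=
    ⟨max p₁ (max 3 (max pmin α⁻¹)), le_max_left _ _,
      lt_of_lt_of_le (by norm_num) ((le_max_left _ _).trans (le_max_right _ _)),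
      le_max_of_le_right (le_max_of_le_right (le_max_left _ _)),
      le_max_of_le_right (le_max_of_le_right (le_max_right _ _))⟩
  have hb₀ : 0 < b₀ := one_pos.trans_le hb₀1
  have hb' : 0 < b₀ ^ α := Real.rpow_pos_of_pos hb₀ α
  have hp'1 : 1 ≤ α * p₀ := by
    have h := mul_le_mul_of_nonneg_left hpα hα.le
    rwa [mul_inv_cancel₀ hα.ne'] at h
  have hcb : 2 * (((0 : ℕ) : ℝ) + 4) ≤ c * b₀ ^ α := by
    have h16 : 0 ≤ 16 / c := by positivity
    have h1 : ((16 / c) ^ α⁻¹) ^ α ≤ b₀ ^ α := Real.rpow_le_rpow (Real.rpow_nonneg h16 _) hbc hα.le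
    rw [Real.rpow_inv_rpow h16 hα.ne'] at h1
    have h2 : 16 / c * c ≤ b₀ ^ α * c := mul_le_mul_of_nonneg_right h1 hc.le
    rw [div_mul_cancel₀ _ hc.ne'] at h2
    push_cast; linarith
  refine ⟨b₀, p₀, hb₁, hp₁, hb₀, hp₀, fun m hm => ?_⟩
  obtain ⟨γ₁, hγ₁, hγ₁1, HF⟩ := H b₀ p₀ hbmin hb₀ hpmin hp₀
  refine ⟨γ₁, hγ₁, fun F γ hFL hγ hγle => ?_⟩
  have hγ1 : γ ≤ 1 := hγle.trans hγ₁1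
  have hp₀1 : 1 ≤ p₀ := by linarith
  -- the bare profile (landed: reflection positivity + chessboard) and the per-height constant
  obtain ⟨q₀, hq₀0, hq₀, -, hbare⟩ := bareTailAt F hγ hγ1 hb₀ hp₀1
  set A' : ℝ := 72 * C * (F.L : ℝ) ^ (3 * F.m) with hA'
  have hA'0 : 0 ≤ A' := by positivity
  obtain ⟨hq0, hq, hqt⟩ := geometric_profile hA'0
  refine historyTailAt_of_bare_finestBad F hγ.le b₀ p₀ hm q₀ (fun i => A' * ((1 : ℝ) / 2) ^ i)
    hq₀0 hq₀ hq0 hq hqt hbare fun K j hj1 hjK => ?_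
  -- one height `1 ≤ j`, `j + 2 ≤ K`: union over plaquettes, the supplier's tail, the count, the arithmetic at the profile `(b₀^α, α·p₀)`
  haveI := isProbabilityMeasure_gibbsK F ℰp hγ.le K
  refine (real_not_plaqSmall_inter_le_sum (gibbsK F ℰp γ K)
    (Averaging.iter (fun i' => BlockAveraging.blockAvg (P := F.P K) (j := i') ℰp) j) (θBal F.L γ b₀ p₀ (K - j))
    {U | ∀ i, i < j → PlaqSmall (θBal F.L γ b₀ p₀ (K - i))
      (Averaging.iter (fun i' => BlockAveraging.blockAvg (P := F.P K) (j := i') ℰp) i U)}).trans ?_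
  refine (Finset.sum_le_sum fun a _ => HF F γ hFL hγ hγle K j hj1 hjK a).trans ?_
  rw [Finset.sum_const, Finset.card_univ, nsmul_eq_mul]
  have hcard := card_plaq_le_pow F (show j ≤ K by omega)
  have hX : 0 ≤ C * Real.exp (-(c * B10.pFun (b₀ ^ α) (α * p₀) (Real.sqrt (γ * ((F.L : ℝ)⁻¹) ^ (K - j))))) := by
    positivity
  have hper := perHeight_bound_lin F hγ hγ1 hb' hp'1 hC 0 hc hcb (K - j)
  simp only [pow_zero, mul_one] at hper
  calc (Fintype.card (Plaq (F.P K) j) : ℝ) *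
        (C * Real.exp (-(c * B10.pFun (b₀ ^ α) (α * p₀) (Real.sqrt (γ * ((F.L : ℝ)⁻¹) ^ (K - j))))))
      ≤ (9 * (8 * (F.L : ℝ) ^ (3 * F.m) * ((F.L : ℝ) ^ (K - j)) ^ 3)) *
          (C * Real.exp (-(c * B10.pFun (b₀ ^ α) (α * p₀) (Real.sqrt (γ * ((F.L : ℝ)⁻¹) ^ (K - j)))))) :=
        mul_le_mul_of_nonneg_right hcard hX
    _ ≤ A' * ((1 : ℝ) / 2) ^ (K - j) := by rw [hA']; exact hper

/-! ## §3 The knit: `HistoryTailL` from a K1 of ANY stretched-exponential class -/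

/-- ★★★ **`UnitScaleTilt.HistoryTailL ⟸ K1-ψ_α ∧ BlockLipschitzL ∧ MeanDeviationL`, FOR EVERY `α > 0`** (BY NAME): line #12 closes the crux
stmt-QuantumFields-19936 from a concentration inequality of ANY STRETCHED-EXPONENTIAL SHAPE for box-local gauge-invariant Lipschitz observables
at the Hodge–Poincaré SCALE `n∕√β_K` — `Gibbs_K{r ≤ f − ∫f} ≤ Cc·exp(−cc·(√β_K·r∕(n·Λ))^α)`, constants depending on `L` only — together with
the route's deterministic K2 (`BlockLipschitzL`) and the shared first-moment crux (`MeanDeviationL`).  `α = 2` is the registered Gaussian crux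
`MesoscopicConcentrationL` (LSI class; `strTail_of_gaussTail`), `α = 1` the exponential K1-exp of ✓`historyTailL_of_expConcentration` (spectral-gap
class; `strTail_of_expTail`), `0 < α < 1` the sub-exponential ∕ ψ_α-Orlicz classes (below spectral gap: weak Poincaré inequalities, moment growth
`‖f − ∫f‖_q ≲ (nΛ∕√β_K)·q^{1∕α}`; the variance ∕ Poincaré face `hVar` of ✓`PoincareLipschitzHistoryTailOfVarianceBound.historyTailL_of_varianceBound`
implies the `α = 1` hypothesis only — the `α < 1` faces are NOT implied by it).  Composition: ✓`local_tail_str` (the global finer-small event lies in the local good set) ∘ B″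
✓`historyTailL_of_stretchedTail`; the price of a small `α` is paid in the PROFILE (`p₀ ≥ 1∕α`), which the crux leaves free.  By the per-height
arithmetic, `α > 0` is also the floor of this consumer: a polynomial concentration of fixed degree `N` gives per-height factors
`(k·log L)^{−N·p₀}` against the plaquette count `L^{3k}` and does not sum.  Route glue only: K1 (in any shape), K2 and `MeanDeviationL` are NOT proved.
[cite: Balaban1985UV3, (7) p.257 and (71) p.273] -/
theorem historyTailL_of_stretchedConcentration (α : ℝ) (hα : 0 < α)
    (hC : ∀ (L : ℕ), ∃ (Cc cc : ℝ), 0 ≤ Cc ∧ 0 < cc ∧ ∃ γ₁ : ℝ, 0 < γ₁ ∧ γ₁ ≤ 1 ∧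
      ∀ (F : T3Family) (γ : ℝ), F.L = L → 0 < γ → γ ≤ γ₁ → ∀ (K n : ℕ), 1 ≤ n →
        (n : ℝ) ≤ (F.scheme ℰp γ).β K → 2 * n ≤ (F.P K).sitesPerDir 0 →
        ∀ (x₀ : Site (F.P K) 0) (f : GaugeField (F.P K) 0 (Matrix.specialUnitaryGroup (Fin 2) ℂ) → ℝ) (Λ : ℝ), 0 < Λ →
          Measurable f → GaugeField.GaugeInvariant f →
          (∀ U U' : GaugeField (F.P K) 0 (Matrix.specialUnitaryGroup (Fin 2) ℂ),
            (∀ b : PBond (F.P K) 0, (∀ k, (b.src k - x₀ k).val < n) → (∀ k, (b.tgt k - x₀ k).val < n) → U b = U' b) →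
              f U = f U') →
          (∀ U U' : GaugeField (F.P K) 0 (Matrix.specialUnitaryGroup (Fin 2) ℂ),
            |f U - f U'| ≤ Λ * Real.sqrt (∑ b : PBond (F.P K) 0, GaugeGroup.dist1 (U b * (U' b)⁻¹) ^ 2)) →
          ∀ r : ℝ, 0 ≤ r →
            (gibbsK F ℰp γ K).real {U | r ≤ f U - ∫ V, f V ∂(gibbsK F ℰp γ K)} ≤
              Cc * Real.exp (-(cc * (Real.sqrt ((F.scheme ℰp γ).β K) * r / ((n : ℝ) * Λ)) ^ α)))
    (hLip : Summit.QuantumFields.YangMills.Theses.PoincareLipschitz.BlockLipschitzL)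
    (hM : Summit.QuantumFields.YangMills.Theses.PoincareLipschitz.MeanDeviationL) :
    Summit.QuantumFields.YangMills.Theses.UnitScaleTilt.HistoryTailL := by
  refine historyTailL_of_stretchedTail hα fun L => ?_
  obtain ⟨bmin, pmin, C, c, hC0, hc, H⟩ := local_tail_str hα hC hLip hM L
  refine ⟨bmin, pmin, C, c, hC0, hc, fun b₀ p₀ hbmin hb₀ hpmin hp₀ => ?_⟩
  obtain ⟨γ₁, hγ₁, hγ₁1, HF⟩ := H b₀ p₀ hbmin hb₀ hpmin hp₀
  refine ⟨γ₁, hγ₁, hγ₁1, fun F γ hFL hγ hle K j hj hjK a => ?_⟩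
  haveI := isProbabilityMeasure_gibbsK F ℰp hγ.le K
  -- the global finer-small event lies in the local good set
  have hsub : ({U : GaugeField (F.P K) 0 (Matrix.specialUnitaryGroup (Fin 2) ℂ) | θBal F.L γ b₀ p₀ (K - j) ≤ GaugeGroup.dist1 (GaugeField.plaqHol (Averaging.iter (fun i' => BlockAveraging.blockAvg (P := F.P K) (j := i') ℰp) j U) a)} ∩
        {U : GaugeField (F.P K) 0 (Matrix.specialUnitaryGroup (Fin 2) ℂ) | ∀ i, i < j → PlaqSmall (θBal F.L γ b₀ p₀ (K - i)) (Averaging.iter (fun i' => BlockAveraging.blockAvg (P := F.P K) (j := i') ℰp) i U)}) ⊆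
      ({U : GaugeField (F.P K) 0 (Matrix.specialUnitaryGroup (Fin 2) ℂ) | θBal F.L γ b₀ p₀ (K - j) ≤ GaugeGroup.dist1 (GaugeField.plaqHol (Averaging.iter (fun i' => BlockAveraging.blockAvg (P := F.P K) (j := i') ℰp) j U) a)} ∩ {U : GaugeField (F.P K) 0 (Matrix.specialUnitaryGroup (Fin 2) ℂ) | (∀ (i : ℕ) (q : Plaq (F.P K) i), i < j → Site.tdist (fun k => ((((q.src k).val * F.L ^ i : ℕ)) : ZMod ((F.P K).sitesPerDir 0))) (fun k => ((((a.src k).val * F.L ^ j : ℕ)) : ZMod ((F.P K).sitesPerDir 0))) + 64 * F.L ^ i ≤ 64 * F.L ^ j → GaugeGroup.dist1 (GaugeField.plaqHol (Averaging.iter (fun i' => BlockAveraging.blockAvg (P := F.P K) (j := i') ℰp) i U) q) < θBal F.L γ b₀ p₀ (K - i))}) := by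
    rintro U ⟨hU1, hU2⟩
    exact ⟨hU1, fun i q hi _ => hU2 i hi q⟩
  exact (measureReal_mono hsub (measure_ne_top _ _)).trans (HF F γ hFL hγ hle K j hj hjK a)

/-- **COROLLARY (α = 2): THE REGISTERED GAUSSIAN CRUX, BY NAME** — `HistoryTailL ⟸ MesoscopicConcentrationL ∧ BlockLipschitzL ∧ MeanDeviationL`
through the ψ_α knit (the tree's own composition of this implication is ✓`twoSidedOfConcentration_proof` ∘
✓`fibreConvexityTail_historyTailOfTwoSided_proof`; this is the same fact as ONE instance of `historyTailL_of_stretchedConcentration`; the `α = 1`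
instance `historyTailL_of_stretchedConcentration 1 one_pos (strTail_of_expTail hC)` is ✓`PoincareLipschitzLinear.historyTailL_of_expConcentration`).
[cite: Balaban1985UV3, (7) p.257 and (71) p.273] -/
theorem historyTailL_of_mesoscopicConcentrationL
    (hC : Summit.QuantumFields.YangMills.Theses.PoincareLipschitz.MesoscopicConcentrationL)
    (hLip : Summit.QuantumFields.YangMills.Theses.PoincareLipschitz.BlockLipschitzL)
    (hM : Summit.QuantumFields.YangMills.Theses.PoincareLipschitz.MeanDeviationL) :
    Summit.QuantumFields.YangMills.Theses.UnitScaleTilt.HistoryTailL :=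
  historyTailL_of_stretchedConcentration 2 two_pos (strTail_of_gaussTail hC) hLip hM

end Summit.QuantumFields.YangMills.Theorems.PoincareLipschitzStretched

end
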